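import Literature.Geometry.Kaehler.ComplexTorusRealMultiplicationLefschetzGroupConnected
import Literature.Geometry.Kaehler.ComplexTorusSiegelLeviConnected
import HarnessLib

/-!
# Milne 1999 §2 at torus level, the commutative capstone: for a polarised complex torus whose endomorphism algebra
# is COMMUTATIVE, reduced and stable under the Rosati involution, `S(X)(ℂ)` is connected — `Lf(X)(ℂ) = S(X)(ℂ)` —
# with blocks `Sp(H_q)` (Rosati-fixed characters: type I) and `U(H_q ⊕ H_{q̄}) ≅ GL` (conjugate pairs of characters:
# type IV with `E = K`, every relative dimension `g/f`)

Layer `Literature/Geometry/Kaehler`, namespace `Literature.Geometry.Kaehler.ComplexTorus`; lane `lit-hodgefound`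
(Track 2 foundations library), Layer A4 (Lefschetz groups), skeleton seat `lit-hodgefound-skel-4` (generation 35),
row A4-94 (b). Sequel BY NAME of row A4-92 `ComplexTorusCMLefschetzGroupConnected` (`exists_forall_map_eq_conj_diagonal`
— a common eigenbasis of a commutative reduced `End_ℚ(X) ⊗ ℂ` —, `rosati_conj_diagonal_eq_iff`, `frameGram_alternating`),
row A4-93 `ComplexTorusRealMultiplicationLefschetzGroupConnected` (`mem_map_map_symplecticGroupC_iff`,
`isZariskiClosed_and_isPrime_map_map_symplecticGroupC`, `exists_transpose_mul_mul_eq_J_submatrix_complex`,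
`det_eq_one_of_transpose_mul_mul_eq_complex`, `conj_symplectic_iff`), row A4-94 (a) `ComplexTorusSiegelLeviConnected`
(`exists_subgroup_unitaryPair`: Milne's Remark 2.2, the unitary group of a split skew-Hermitian space is a conjugate of
the Siegel Levi `{diag(g, ᵗg⁻¹)} ≅ GL_l`, connected), p36's `ComplexTorusLefschetzGroupSigmaPiIdentityComponent`
(`isPrime_vanishingIdealC_sigmaPi_map`, `sigmaBlockDiagSL`), p22's `reindexSLC` / `conjGLC` transports, and p17's
`lefschetzIdentityC_eq_of_isPrime`.

## Sources, verbatim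

* [Milne1999LefschetzClasses] J. S. Milne, *Lefschetz classes on abelian varieties*, Duke Math. J. 96 (1999), §2.
  Preliminaries (p. 646): «`V(A) = V₁ ⊕ ⋯ ⊕ V_t`, `V_i = e_i V` […] Any `k`-linear map `α : V → V` commuting with the
  action of `F` decomposes into `α = α₁ ⊕ ⋯ ⊕ α_t`». Remark 2.2 (p. 647–648): «Let `k'` be an étale `k`-algebra of
  degree 2 […] `φ` a nondegenerate skew-Hermitian form […] `V ⊗_k Ω = V₁ ⊕ V₂` […] `φ|V₁ × V₁ = 0 = φ|V₂ × V₂`, and there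
  is a nondegenerate `Ω`-bilinear form `φ₁ : V₁ × V₂ → Ω` such that `φ((x₁, x₂), (y₁, y₂)) = (φ₁(x₁, y₂), −φ₁(x₂, y₁))`
  […] Therefore, the map `α ↦ α|V₁ : U(φ)_Ω → GL(V₁)` is an isomorphism». «Simple abelian variety of type I» (p. 648–649):
  «`S(A)_{k^al} ≅ ∏_{σ : F → k^al} Sp(φ_σ)`». «Simple abelian variety of type IV» (p. 651): «the first of which carries
  the Rosati involution on `E_σ` into the involution `†` on `Ē` […] `S(A)_{/k^al} = ∏ S_σ` where
  `S_σ ≈ Aut(V₁) ≈ GL(k^al)`». Summary table (p. 652): «I ∣ Sp ∣ Yes ∣ Yes», «IV ∣ GL ∣ No ∣ Yes» (columns `A`, `S(A)`,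
  Semisimple, Connected).
* [Lange2023AbelianVarietiesComplex] H. Lange, *Abelian Varieties over the Complex Numbers* (2023), §2.4.1 Lemma 2.4.1
  (the Rosati involution is an anti-involution of `End_ℚ(X)`), §7.2.4 Exercise (4) (`Lf(X) = S(X)⁰`).
* [Springer1998] T. A. Springer, *Linear Algebraic Groups*, 2nd ed. (1998), Exercise 2.2.2 (1), Exercise 2.2.9 (1)(b),
  Prop. 2.2.1, Thm. 1.5.4 (ii) (products of irreducible varieties are irreducible).

## The argument (Milne §2 in a frame; no field theory is needed at torus level)

Let `P` be a common eigenbasis of `End_ℚ(X) ⊗ ℂ` (`A ⊗ 1 = P diag(c_A) P⁻¹`), `H = ᵗP Γ P` the frame Gram matrix of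
the alternating non-degenerate `Γ = G ⊗ 1`, and `q(i) = (A ↦ c_A(i))` the character of the eigenline `i`. Rosati
stability, `(P diag(c_A) P⁻¹)† = P diag(c_{A†}) P⁻¹`, reads `c_A(i) H_{ik} = H_{ik} c_{A†}(k)`
(`rosati_conj_diagonal_eq_iff`); so `H_{ik} ≠ 0` forces `q(k) = q(i) ∘ †` — the line `k` is a PARTNER of `i` — and
«partner» is a symmetric relation (`†† = 1`) under which every line has partners, all in one character class (§3).
Hence `q ↦ q ∘ †` is an involution `π` on the character classes, `H` is block diagonal for the partition of the lines
into `π`-ORBITS (one or two classes), and a matrix commuting with `End_ℚ(X) ⊗ ℂ` is block diagonal for the CLASSES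
(p. 646). So `S(X)(ℂ) = P · (∏_O S_O) · P⁻¹` over the orbits `O`: for `O = {q}` (`πq = q`, the Rosati involution fixes
the character: type I behaviour) `S_O = Sp(H_q)` (p. 649), a conjugate of a standard symplectic group (row A4-93); for
`O = {q, πq}` (`πq ≠ q`: type IV / CM behaviour) `H_O` vanishes on `V_q × V_q` and `V_{πq} × V_{πq}` and `S_O` is the
unitary group of the split pair, `≅ GL(V_q)` (Remark 2.2, row A4-94 (a)). Both kinds are irreducible, the product is
irreducible (`isPrime_vanishingIdealC_sigmaPi_map`), and so is its `GL`-conjugate: `I_ℂ(S(X)(ℂ))` is prime, i.e.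
`Lf(X)(ℂ) = S(X)(ℂ)` (`lefschetzIdentityC_eq_of_isPrime`). Rows A4-92 (`[End_ℚ(X) : ℚ] = 2g`: all orbits are pairs of
single lines) and A4-93 (`† = 1`: all orbits are single classes) are the two extreme cases.

## What is proved (one definition with body — the set `classDiagSet` of class-constant diagonal matrices —, everything
## else theorems; no named fact, net debt 0)

* §1 `classDiagSet f` and `mem_centralizer_classDiagSet_iff`: a matrix of determinant one centralises the
  class-constant diagonal matrices of determinant one iff it is block diagonal for the classes of `f`.
* §2 `isPrime_vanishingIdealC_of_pair`: the block of a two-class orbit is irreducible (Remark 2.2 transported along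
  `κ ≃ V_q ⊕ V_q`, `|V_q| = |V_{πq}|` by a trace count).
* §3 **`isPrime_vanishingIdealC_lefschetzGroupC_of_endAlgRat_comm'`**,
  **`lefschetzIdentityC_eq_lefschetzGroupC_of_endAlgRat_comm'`** (torus level; hypotheses: `End_ℚ(X)` commutative and
  reduced, `G` alternating non-degenerate, `rosati G` stabilises `End_ℚ(X)`), the polarised forms
  `IsRiemannForm.lefschetzIdentityC_eq_lefschetzGroupC_of_endAlgRat_comm'` / `…isPrime…` / real points
  `IsRiemannForm.lefschetzIdentity_eq_lefschetzGroup_of_endAlgRat_comm'`, and §4 the isogeny-product form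
  `IsIsogenous.lefschetzIdentityC_eq_lefschetzGroupC_of_powers_of_endAlgRat_comm'`.
-/

noncomputable section

open Matrix

namespace Literature.Geometry.Kaehler

namespace ComplexTorus

/-! ## §1 Block-diagonal matrices for a partition as a centraliser -/

section ClassBlocks

variable {κ : Type*} [Fintype κ] [DecidableEq κ] {α : Type*} (f : κ → α)

/-- **The class-constant diagonal matrices of determinant one** for a «class» function `f : κ → α`: `diag(d)` with
`d` constant on the fibres of `f` (the torus `∏_q G_m` of scalars on `V = ⊕_q V_q`, intersected with `SL`). Their
centraliser is the algebra of block matrices: «Any `k`-linear map `α : V → V` commuting with the action of `F`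
decomposes into `α = α₁ ⊕ ⋯ ⊕ α_t`». [cite: Milne1999LefschetzClasses, §2 Preliminaries (p. 646)] -/
def classDiagSet : Set (SpecialLinearGroup κ ℂ) :=
  {D | ∃ d : κ → ℂ, (D : Matrix κ κ ℂ) = diagonal d ∧ ∀ x y, f x = f y → d x = d y}

omit [Fintype κ] [DecidableEq κ] in
/-- `2^n ≠ 1` in `ℂ` for `n ≠ 0`. [folklore] -/
private theorem two_pow_ne_one_cc {n : ℕ} (hn : n ≠ 0) : (2 : ℂ) ^ n ≠ 1 := by
  intro h
  have h' : ((2 : ℝ) ^ n : ℝ) = 1 := by exact_mod_cast (show ((2 : ℝ) ^ n : ℂ) = 1 by push_cast; exact h)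
  have h1 : (1 : ℝ) < 2 ^ n := one_lt_pow₀ (by norm_num) hn
  rw [h'] at h1
  exact lt_irrefl _ h1

/-- Two lines in different classes are separated by a class-constant diagonal matrix of determinant one. [folklore] -/
private theorem exists_mem_classDiagSet_apply_ne {x y : κ} (hxy : f x ≠ f y) :
    ∃ D ∈ classDiagSet f, ∃ d : κ → ℂ, (D : Matrix κ κ ℂ) = diagonal d ∧ d x ≠ d y := by
  classical
  set m := (Finset.univ.filter fun z ↦ f z = f x).card with hm_def
  set r := (Finset.univ.filter fun z ↦ ¬f z = f x).card with hr_def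
  have hm : 0 < m := Finset.card_pos.2 ⟨x, Finset.mem_filter.2 ⟨Finset.mem_univ _, rfl⟩⟩
  have hr : 0 < r := Finset.card_pos.2 ⟨y, Finset.mem_filter.2 ⟨Finset.mem_univ _, Ne.symm hxy⟩⟩
  obtain ⟨a, ha⟩ := IsAlgClosed.exists_pow_nat_eq ((2 : ℂ) ^ r)⁻¹ hm
  have ha2 : a ≠ 2 := by
    rintro rfl
    have h : (2 : ℂ) ^ (m + r) = 1 := by rw [pow_add, ha, inv_mul_cancel₀ (pow_ne_zero _ two_ne_zero)]
    exact two_pow_ne_one_cc (by omega) h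
  let d : κ → ℂ := fun z ↦ if f z = f x then a else 2
  have hdet : (diagonal d).det = 1 := by
    rw [det_diagonal, Finset.prod_ite, Finset.prod_const, Finset.prod_const, ← hm_def, ← hr_def, ha,
      inv_mul_cancel₀ (pow_ne_zero _ two_ne_zero)]
  refine ⟨⟨diagonal d, hdet⟩, ⟨d, rfl, fun z z' hzz' ↦ by simp only [d, hzz']⟩, d, rfl, ?_⟩
  simp only [d, if_pos rfl, if_neg (Ne.symm hxy)]
  exact ha2

/-- **Block matrices = the centraliser of the class-constant scalars.** A matrix of determinant one commutes with
every class-constant diagonal matrix of determinant one iff its entries between different classes vanish («Any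
`k`-linear map commuting with the action of `F` decomposes into `α = α₁ ⊕ ⋯ ⊕ α_t`»).
[cite: Milne1999LefschetzClasses, §2 Preliminaries (p. 646)] -/
theorem mem_centralizer_classDiagSet_iff (N : SpecialLinearGroup κ ℂ) :
    N ∈ Subgroup.centralizer (classDiagSet f) ↔ ∀ x y, f x ≠ f y → (N : Matrix κ κ ℂ) x y = 0 := by
  rw [Subgroup.mem_centralizer_iff]
  constructor
  · intro h x y hxy
    obtain ⟨D, hD, d, hDd, hd⟩ := exists_mem_classDiagSet_apply_ne f hxy
    have h1 := congrArg (fun M : SpecialLinearGroup κ ℂ ↦ (M : Matrix κ κ ℂ) x y) (h D hD)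
    simp only [Matrix.SpecialLinearGroup.coe_mul, hDd, diagonal_mul, mul_diagonal] at h1
    have h2 : (d x - d y) * (N : Matrix κ κ ℂ) x y = 0 := by linear_combination h1
    exact (mul_eq_zero.1 h2).resolve_left (sub_ne_zero.2 hd)
  · rintro h D ⟨d, hDd, hd⟩
    refine Subtype.ext ?_
    rw [Matrix.SpecialLinearGroup.coe_mul, Matrix.SpecialLinearGroup.coe_mul, hDd]
    ext x y
    rw [diagonal_mul, mul_diagonal]
    by_cases hxy : f x = f y
    · rw [hd x y hxy, mul_comm]
    · rw [h x y hxy, mul_zero, zero_mul]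

end ClassBlocks

/-! ## §2 The block of a two-class orbit `{q, πq}`: Milne's Remark 2.2 transported along `κ ≃ V_q ⊕ V_q` -/

section Pair

variable {κ : Type*} [Fintype κ] [DecidableEq κ] {α : Type*}

/-- **The unitary block of a conjugate pair of characters is irreducible.** Let `f : κ → α` have at most two classes,
`q` and its complement, let `Hb` be alternating and invertible on `ℂ^κ` vanishing inside each class
(«`φ|V₁ × V₁ = 0 = φ|V₂ × V₂`»), and let `K ≤ SL_κ(ℂ)` consist of the block matrices for `f` preserving `Hb`. Then
`|V_q| = |V_{q̄}|` (the pairing `φ₁ : V₁ × V₂ → Ω` is nondegenerate) and `K` is, after `κ ≃ V_q ⊕ V_q`, the unitary pair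
of row A4-94 (a) — a conjugate of the Siegel Levi `≅ GL(V_q)` —, so `I_ℂ(K)` is prime.
[cite: Milne1999LefschetzClasses, §2 Remark 2.2 (p. 647–648: «the map `α ↦ α|V₁ : U(φ)_Ω → GL(V₁)` is an isomorphism»)]
[cite: Springer1998, Exercise 2.2.2 (1) and Prop. 2.2.1] -/
theorem isPrime_vanishingIdealC_of_pair (f : κ → α) (q : α) {Hb : Matrix κ κ ℂ} (hHt : Hbᵀ = -Hb)
    (hHu : IsUnit Hb.det) (hzero : ∀ x y, f x = f y → Hb x y = 0) (htwo : ∀ x y, f x ≠ q → f y ≠ q → f x = f y)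
    {K : Subgroup (SpecialLinearGroup κ ℂ)}
    (hK : ∀ N, N ∈ K ↔ (N : Matrix κ κ ℂ)ᵀ * Hb * N = Hb ∧ ∀ x y, f x ≠ f y → (N : Matrix κ κ ℂ) x y = 0) :
    (vanishingIdealC K).IsPrime := by
  classical
  -- the splitting `κ = V₁ ⊔ V₂`, `V₁ = f⁻¹(q)`
  let p : κ → Prop := fun z ↦ f z = q
  let e₁ : κ ≃ {z // p z} ⊕ {z // ¬p z} := (Equiv.sumCompl p).symm
  have he₁l : ∀ i : {z // p z}, e₁.symm (Sum.inl i) = i.1 := fun i ↦ rfl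
  have he₁r : ∀ j : {z // ¬p z}, e₁.symm (Sum.inr j) = j.1 := fun j ↦ rfl
  -- `|V₁| = |V₂|`: `Hb = (0 A; B 0)` invertible, `A W = 1`, `W A = 1`, traces
  set H₁ : Matrix ({z // p z} ⊕ {z // ¬p z}) ({z // p z} ⊕ {z // ¬p z}) ℂ := Hb.submatrix e₁.symm e₁.symm
    with hH₁_def
  have hH₁u : IsUnit H₁.det := by
    rw [hH₁_def, det_submatrix_equiv_self]
    exact hHu
  obtain ⟨A, Bm, hH₁eq⟩ : ∃ (A : Matrix {z // p z} {z // ¬p z} ℂ) (Bm : Matrix {z // ¬p z} {z // p z} ℂ),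
      H₁ = fromBlocks 0 A Bm 0 := by
    refine ⟨H₁.toBlocks₁₂, H₁.toBlocks₂₁, ?_⟩
    ext (i | i) (j | j)
    · rw [fromBlocks_apply₁₁, Matrix.zero_apply, hH₁_def, Matrix.submatrix_apply, he₁l, he₁l]
      exact hzero _ _ (i.2.trans j.2.symm)
    · rw [fromBlocks_apply₁₂]
      rfl
    · rw [fromBlocks_apply₂₁]
      rfl
    · rw [fromBlocks_apply₂₂, Matrix.zero_apply, hH₁_def, Matrix.submatrix_apply, he₁r, he₁r]
      exact hzero _ _ (htwo _ _ i.2 j.2)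
  obtain ⟨X, Y, W, Z, hi⟩ : ∃ X Y W Z, H₁⁻¹ = fromBlocks X Y W Z := ⟨_, _, _, _, (fromBlocks_toBlocks _).symm⟩
  have hAW : A * W = 1 := by
    have h := mul_nonsing_inv H₁ hH₁u
    rw [hi, hH₁eq, fromBlocks_multiply, ← fromBlocks_one] at h
    have h1 := (fromBlocks_inj.1 h).1
    rwa [Matrix.zero_mul, zero_add] at h1
  have hWA : W * A = 1 := by
    have h := nonsing_inv_mul H₁ hH₁u
    rw [hi, hH₁eq, fromBlocks_multiply, ← fromBlocks_one] at h
    have h1 := (fromBlocks_inj.1 h).2.2.2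
    rwa [Matrix.mul_zero, add_zero] at h1
  have hcard : Fintype.card {z // ¬p z} = Fintype.card {z // p z} := by
    have h := Matrix.trace_mul_comm A W
    rw [hAW, hWA, trace_one, trace_one] at h
    exact_mod_cast h.symm
  let β : {z // ¬p z} ≃ {z // p z} := Fintype.equivOfCardEq hcard
  -- `κ ≃ V₁ ⊕ V₁`
  let e : κ ≃ {z // p z} ⊕ {z // p z} := e₁.trans (Equiv.sumCongr (Equiv.refl _) β)
  have hel : ∀ i : {z // p z}, e.symm (Sum.inl i) = i.1 := fun i ↦ rfl
  have her : ∀ j : {z // p z}, e.symm (Sum.inr j) = (β.symm j).1 := fun j ↦ rfl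
  set Hr : Matrix ({z // p z} ⊕ {z // p z}) ({z // p z} ⊕ {z // p z}) ℂ := Hb.submatrix e.symm e.symm with hHr_def
  have hHrt : Hrᵀ = -Hr := by
    rw [hHr_def, transpose_submatrix, hHt]
    rfl
  have hHru : IsUnit Hr.det := by
    rw [hHr_def, det_submatrix_equiv_self]
    exact hHu
  have hHr₁₁ : ∀ i j, Hr (Sum.inl i) (Sum.inl j) = 0 := fun i j ↦ by
    rw [hHr_def, Matrix.submatrix_apply, hel, hel]
    exact hzero _ _ (i.2.trans j.2.symm)
  have hHr₂₂ : ∀ i j, Hr (Sum.inr i) (Sum.inr j) = 0 := fun i j ↦ by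
    rw [hHr_def, Matrix.submatrix_apply, her, her]
    exact hzero _ _ (htwo _ _ (β.symm i).2 (β.symm j).2)
  have hHrsub : Hr.submatrix e e = Hb := by
    rw [hHr_def, Matrix.submatrix_submatrix, Equiv.symm_comp_self, Matrix.submatrix_id_id]
  -- Milne's Remark 2.2 (row A4-94 (a))
  obtain ⟨K', -, hK'p, hK'mem⟩ := exists_subgroup_unitaryPair hHrt hHru hHr₁₁ hHr₂₂
  suffices hKK' : K = K'.map (reindexSLC e.symm).toMonoidHom by
    rw [hKK']
    exact isPrime_vanishingIdealC_map_reindexSLC e.symm hK'p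
  ext N
  rw [hK, Subgroup.mem_map_equiv, hK'mem, coe_reindexSLC_symm,
    transpose_mul_mul_submatrix_eq_iff e Hr, hHrsub]
  refine and_congr Iff.rfl ⟨fun h ↦ ⟨fun i j ↦ ?_, fun i j ↦ ?_⟩, fun h x y hxy ↦ ?_⟩
  · rw [Matrix.submatrix_apply, hel, her]
    exact h _ _ (by rw [i.2]; exact Ne.symm (β.symm j).2)
  · rw [Matrix.submatrix_apply, hel, her]
    exact h _ _ (by rw [j.2]; exact (β.symm i).2)
  · by_cases hx : p x
    · have hy : ¬p y := fun hy ↦ hxy (hx.trans hy.symm)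
      have h1 := h.1 ⟨x, hx⟩ (β ⟨y, hy⟩)
      rwa [Matrix.submatrix_apply, hel, her, Equiv.symm_apply_apply] at h1
    · have hy : p y := by
        by_contra hy
        exact hxy (htwo x y hx hy)
      have h1 := h.2 (β ⟨x, hx⟩) ⟨y, hy⟩
      rwa [Matrix.submatrix_apply, her, hel, Equiv.symm_apply_apply] at h1

end Pair

/-! ## §3 Milne 1999 §2 at torus level: `S(X)(ℂ)` for `End_ℚ(X)` commutative, reduced, Rosati-stable -/

section Commutative

variable {ι : Type*} [Fintype ι] [DecidableEq ι] {E : Type*} [NormedAddCommGroup E] [NormedSpace ℂ E]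
  (Φ : (ι → ℝ) ≃L[ℝ] E)

/-- `det (G ⊗ 1) ≠ 0`. [folklore] -/
private theorem isUnit_det_map_algebraMap_cc {G : Matrix ι ι ℚ} (hGu : IsUnit G.det) :
    IsUnit (G.map (algebraMap ℚ ℂ)).det := by
  rw [show G.map (algebraMap ℚ ℂ) = (algebraMap ℚ ℂ).mapMatrix G from rfl, ← RingHom.map_det]
  exact hGu.map _

omit [Fintype ι] [DecidableEq ι] in
/-- `ᵗ(G ⊗ 1) = -(G ⊗ 1)`. [folklore] -/
private theorem transpose_map_algebraMap_cc {G : Matrix ι ι ℚ} (hGt : Gᵀ = -G) :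
    (G.map (algebraMap ℚ ℂ))ᵀ = -G.map (algebraMap ℚ ℂ) := by
  rw [← Matrix.transpose_map, hGt, Matrix.map_neg _ (map_neg (algebraMap ℚ ℂ))]

/-- Commutation in a frame: `(P B P⁻¹)(P D P⁻¹) = (P D P⁻¹)(P B P⁻¹) ⟺ B D = D B`. [folklore] -/
private theorem conjFrame_mul_comm_iff_cc {P : Matrix ι ι ℂ} (hP : IsUnit P.det) (B D : Matrix ι ι ℂ) :
    P * B * P⁻¹ * (P * D * P⁻¹) = P * D * P⁻¹ * (P * B * P⁻¹) ↔ B * D = D * B := by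
  have hl : ∀ X Y : Matrix ι ι ℂ, P * X * P⁻¹ * (P * Y * P⁻¹) = P * (X * Y) * P⁻¹ := fun X Y ↦ by
    rw [show P * X * P⁻¹ * (P * Y * P⁻¹) = P * X * (P⁻¹ * P) * Y * P⁻¹ by simp only [Matrix.mul_assoc],
      Matrix.nonsing_inv_mul _ hP, Matrix.mul_one, Matrix.mul_assoc P X]
  rw [hl, hl]
  constructor
  · intro h
    have h' := congrArg (fun X ↦ P⁻¹ * X * P) h
    rw [show P⁻¹ * (P * (B * D) * P⁻¹) * P = P⁻¹ * P * (B * D) * (P⁻¹ * P) by simp only [Matrix.mul_assoc],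
      show P⁻¹ * (P * (D * B) * P⁻¹) * P = P⁻¹ * P * (D * B) * (P⁻¹ * P) by simp only [Matrix.mul_assoc],
      Matrix.nonsing_inv_mul _ hP, Matrix.one_mul, Matrix.mul_one, Matrix.one_mul, Matrix.mul_one] at h'
    exact h'
  · intro h
    rw [h]

omit [Fintype ι] in
/-- A matrix commutes with `diag(c)` iff its entries vanish where `c` differs. [folklore] -/
private theorem mul_diagonal_comm_iff_cc [Fintype ι] (B : Matrix ι ι ℂ) (c : ι → ℂ) :
    B * diagonal c = diagonal c * B ↔ ∀ i k, c i ≠ c k → B i k = 0 := by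
  constructor
  · intro h i k hik
    have h1 := congrFun (congrFun h i) k
    rw [mul_diagonal, diagonal_mul] at h1
    have h2 : (c i - c k) * B i k = 0 := by linear_combination -h1
    exact (mul_eq_zero.1 h2).resolve_left (sub_ne_zero.2 hik)
  · intro h
    ext i k
    rw [mul_diagonal, diagonal_mul]
    by_cases hik : c i = c k
    · rw [hik, mul_comm]
    · rw [h i k hik, mul_zero, zero_mul]

/-- **MILNE 1999 §2 AT TORUS LEVEL, THE COMMUTATIVE CASE — `S(X)(ℂ)` IS CONNECTED (its complex vanishing ideal is
prime).** Let `X = E/Φ(ℤ^ι)` be a complex torus whose endomorphism algebra `End_ℚ(X)` is commutative and reduced, and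
let `G ∈ M_ι(ℚ)` be alternating and non-degenerate with `End_ℚ(X)` stable under the Rosati involution `rosati G` (e.g.
the rational Gram matrix of a polarisation). In a common eigenbasis `P` of `End_ℚ(X) ⊗ ℂ` the Rosati involution acts
on the character classes of the eigenlines by an involution `π` («carries the Rosati involution on `E_σ` into the
involution `†`»), the frame Gram matrix `H = ᵗPΓP` is block diagonal for the `π`-orbits, and
`S(X)(ℂ) = P · (∏_O S_O) · P⁻¹` with `S_O = Sp(H_q)` for a fixed class `O = {q}` («`S(A)_{k^al} ≅ ∏ Sp(φ_σ)`», type I)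
and `S_O = U(H_O) ≅ GL(V_q)` for a pair `O = {q, πq}` («`φ|V₁ × V₁ = 0 = φ|V₂ × V₂` … `α ↦ α|V₁ : U(φ)_Ω → GL(V₁)` is an
isomorphism», «`S_σ ≈ GL`», type IV); each block is irreducible and so is the product: «I ∣ Sp ∣ Connected: Yes»,
«IV ∣ GL ∣ Connected: Yes». [cite: Milne1999LefschetzClasses, §2 Preliminaries (p. 646), Remark 2.2 (p. 647–648), type I (p. 648–649), type IV (p. 651), Summary table (p. 652)]
[cite: Springer1998, Exercise 2.2.2 (1), Exercise 2.2.9 (1)(b), Thm. 1.5.4 (ii), Prop. 2.2.1] -/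
theorem isPrime_vanishingIdealC_lefschetzGroupC_of_endAlgRat_comm' [IsReduced (endAlgRat Φ)]
    (hcomm : ∀ a ∈ endAlgRat Φ, ∀ b ∈ endAlgRat Φ, a * b = b * a)
    {G : Matrix ι ι ℚ} (hGt : Gᵀ = -G) (hGu : IsUnit G.det) (hEnd : ∀ A ∈ endAlgRat Φ, rosati G A ∈ endAlgRat Φ) :
    (vanishingIdealC (lefschetzGroupC Φ G)).IsPrime := by
  classical
  set Γ : Matrix ι ι ℂ := G.map (algebraMap ℚ ℂ) with hΓ_def
  have hΓu : IsUnit Γ.det := isUnit_det_map_algebraMap_cc hGu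
  have hΓt : Γᵀ = -Γ := transpose_map_algebraMap_cc hGt
  -- a common eigenbasis `P` of `End_ℚ(X) ⊗ ℂ` and the characters `c`
  obtain ⟨P, hP, hT⟩ := exists_forall_map_eq_conj_diagonal (endAlgRat Φ) hcomm
  choose! c hc using hT
  -- the frame Gram matrix
  obtain ⟨hHt, -, hcol⟩ := frameGram_alternating hP hΓu hΓt
  set H : Matrix ι ι ℂ := Pᵀ * Γ * P with hH_def
  have hHu : IsUnit H.det := by
    rw [hH_def, det_mul, det_mul, det_transpose]
    exact (hP.mul hΓu).mul hP
  have hdd : ∀ t, rosati G (rosati G t) = t := fun t ↦ rosati_rosati hGu hGt t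
  -- Rosati stability in the frame: `c_t(i) H_{ik} = H_{ik} c_{t†}(k)`
  have hHros : ∀ t ∈ endAlgRat Φ, ∀ i k, c t i * H i k = H i k * c (rosati G t) k := by
    intro t ht i k
    have hros : rosati Γ (t.map (algebraMap ℚ ℂ)) = (rosati G t).map (algebraMap ℚ ℂ) := by
      rw [hΓ_def, ← rosati_map (algebraMap ℚ ℂ) hGu t]
    rw [hc t ht, hc _ (hEnd t ht)] at hros
    have h := (rosati_conj_diagonal_eq_iff hP hΓu _ _).1 hros
    rw [← hH_def] at h
    have h1 := congrFun (congrFun h i) k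
    rwa [diagonal_mul, mul_diagonal] at h1
  -- the partner relation `R i k`: the character of `k` is the `†`-twist of the character of `i`
  let R : ι → ι → Prop := fun i k ↦ ∀ t ∈ endAlgRat Φ, c t i = c (rosati G t) k
  have hR_of_H : ∀ i k, H i k ≠ 0 → R i k := fun i k hik t ht ↦
    mul_right_cancel₀ hik ((hHros t ht i k).trans (mul_comm _ _))
  have hR_symm : ∀ i k, R i k → R k i := fun i k h t ht ↦ by
    have h1 := h (rosati G t) (hEnd t ht)
    rw [hdd] at h1
    exact h1.symm
  have hR_cls : ∀ i k k', R i k → R i k' → ∀ t ∈ endAlgRat Φ, c t k = c t k' := fun i k k' hk hk' t ht ↦ by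
    have h1 := hk (rosati G t) (hEnd t ht)
    have h2 := hk' (rosati G t) (hEnd t ht)
    rw [hdd] at h1 h2
    exact h1.symm.trans h2
  have hR_congr : ∀ i i' k k', R i k → (∀ t ∈ endAlgRat Φ, c t i = c t i') →
      (∀ t ∈ endAlgRat Φ, c t k = c t k') → R i' k' := fun i i' k k' h hi hk t ht ↦ by
    rw [← hi t ht, h t ht, hk _ (hEnd t ht)]
  -- the partition of the eigenlines by character (classes) and by `π`-orbit (class or partner)
  let s : Setoid ι := ⟨fun i k ↦ ∀ t ∈ endAlgRat Φ, c t i = c t k,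
    ⟨fun _ _ _ ↦ rfl, fun h t ht ↦ (h t ht).symm, fun h₁ h₂ t ht ↦ (h₁ t ht).trans (h₂ t ht)⟩⟩
  let cls : ι → Quotient s := Quotient.mk s
  have hcls : ∀ i k, cls i = cls k ↔ ∀ t ∈ endAlgRat Φ, c t i = c t k := fun i k ↦ Quotient.eq (r := s)
  have hO_trans : ∀ i j k, ((∀ t ∈ endAlgRat Φ, c t i = c t j) ∨ R i j) →
      ((∀ t ∈ endAlgRat Φ, c t j = c t k) ∨ R j k) → ((∀ t ∈ endAlgRat Φ, c t i = c t k) ∨ R i k) := by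
    rintro i j k (hij | hij) (hjk | hjk)
    · exact Or.inl fun t ht ↦ (hij t ht).trans (hjk t ht)
    · exact Or.inr (hR_congr j i k k hjk (fun t ht ↦ (hij t ht).symm) fun _ _ ↦ rfl)
    · exact Or.inr (hR_congr i i j k hij (fun _ _ ↦ rfl) hjk)
    · exact Or.inl (hR_cls j i k (hR_symm i j hij) hjk)
  let so : Setoid ι := ⟨fun i k ↦ (∀ t ∈ endAlgRat Φ, c t i = c t k) ∨ R i k,
    ⟨fun _ ↦ Or.inl fun _ _ ↦ rfl,
      fun h ↦ h.elim (fun h ↦ Or.inl fun t ht ↦ (h t ht).symm) fun h ↦ Or.inr (hR_symm _ _ h),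
      fun h₁ h₂ ↦ hO_trans _ _ _ h₁ h₂⟩⟩
  let ocls : ι → Quotient so := Quotient.mk so
  have hocls : ∀ i k, ocls i = ocls k ↔ (∀ t ∈ endAlgRat Φ, c t i = c t k) ∨ R i k := fun i k ↦
    Quotient.eq (r := so)
  have hocls_of_cls : ∀ i k, cls i = cls k → ocls i = ocls k := fun i k h ↦ (hocls i k).2 (Or.inl ((hcls i k).1 h))
  let fib : Quotient so → Type _ := fun o ↦ {i : ι // ocls i = o}
  let eσ : (Σ o, fib o) ≃ ι := Equiv.sigmaFiberEquiv ocls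
  have heσ : ∀ x : Σ o, fib o, ocls (eσ x) = x.1 := fun x ↦ x.2.2
  -- `H` is block diagonal for the orbits
  have hHzero : ∀ i k, ocls i ≠ ocls k → H i k = 0 := fun i k hik ↦ by
    by_contra h
    exact hik ((hocls i k).2 (Or.inr (hR_of_H i k h)))
  set H' : Matrix (Σ o, fib o) (Σ o, fib o) ℂ := H.submatrix eσ eσ with hH'_def
  set Hb : ∀ o, Matrix (fib o) (fib o) ℂ := fun o ↦ Matrix.blockDiag' H' o with hHb_def
  have hH'zero : ∀ x x' : Σ o, fib o, x.1 ≠ x'.1 → H' x x' = 0 := fun x x' hxx' ↦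
    hHzero _ _ (by rwa [heσ, heσ])
  have hH'eq : H' = Matrix.blockDiagonal' Hb := eq_blockDiagonal'_blockDiag'_of_apply_eq_zero hH'zero
  have hHbt : ∀ o, (Hb o)ᵀ = -Hb o := fun o ↦ by
    ext x y
    have h := congrFun (congrFun hHt (eσ ⟨o, x⟩)) (eσ ⟨o, y⟩)
    rw [transpose_apply, Matrix.neg_apply] at h
    rw [transpose_apply, Matrix.neg_apply]
    change H (eσ ⟨o, y⟩) (eσ ⟨o, x⟩) = -H (eσ ⟨o, x⟩) (eσ ⟨o, y⟩)
    exact h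
  have hHbu : ∀ o, IsUnit (Hb o).det := fun o ↦ by
    refine isUnit_det_of_isUnit_det_blockDiagonal' ?_ o
    rw [← hH'eq, hH'_def, Matrix.det_submatrix_equiv_self]
    exact hHu
  have hHb_apply : ∀ o (x y : fib o), Hb o x y = H x.1 y.1 := fun o x y ↦ rfl
  -- inside an orbit: `H` pairs different classes of a two-class orbit, and an orbit has at most two classes
  have hpair : ∀ o (x y : fib o), (∃ x' y' : fib o, cls x'.1 ≠ cls y'.1) → cls x.1 = cls y.1 → Hb o x y = 0 := by
    rintro o x y ⟨x', y', hx'y'⟩ hxy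
    by_contra h
    rw [hHb_apply] at h
    have hRxx : R x.1 x.1 := hR_congr x.1 x.1 y.1 x.1 (hR_of_H _ _ h) (fun _ _ ↦ rfl)
      fun t ht ↦ ((hcls _ _).1 hxy t ht).symm
    have hall : ∀ z : fib o, cls z.1 = cls x.1 := fun z ↦ by
      rcases (hocls x.1 z.1).1 (x.2.trans z.2.symm) with hxz | hxz
      · exact ((hcls _ _).2 hxz).symm
      · exact ((hcls _ _).2 (hR_cls x.1 x.1 z.1 hRxx hxz)).symm
    exact hx'y' ((hall x').trans (hall y').symm)
  have htwo : ∀ o (x₀ x y : fib o), cls x.1 ≠ cls x₀.1 → cls y.1 ≠ cls x₀.1 → cls x.1 = cls y.1 := by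
    intro o x₀ x y hx hy
    rcases (hocls x₀.1 x.1).1 (x₀.2.trans x.2.symm) with h₁ | h₁
    · exact absurd ((hcls _ _).2 h₁).symm hx
    rcases (hocls x₀.1 y.1).1 (x₀.2.trans y.2.symm) with h₂ | h₂
    · exact absurd ((hcls _ _).2 h₂).symm hy
    exact (hcls _ _).2 (hR_cls x₀.1 x.1 y.1 h₁ h₂)
  -- the blocks: `Sp(H_o)(ℂ) ∩ (block matrices for the classes inside the orbit)`
  have hSB : ∀ o, ∃ (n : ℕ) (e : fib o ≃ Fin n ⊕ Fin n) (Q : Matrix (fib o) (fib o) ℂ), IsUnit Q.det ∧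
      Qᵀ * Hb o * Q = (Matrix.J (Fin n) ℂ).submatrix e e := fun o ↦
    exists_transpose_mul_mul_eq_J_submatrix_complex (hHbt o) (hHbu o)
  choose n e Q hQ hQHQ using hSB
  let K : ∀ o, Subgroup (Matrix.SpecialLinearGroup (fib o) ℂ) := fun o ↦
    ((symplecticGroupC (Fin (n o))).map (reindexSLC (e o).symm).toMonoidHom).map (conjGLC (Q o) (hQ o)).toMonoidHom ⊓
      Subgroup.centralizer (classDiagSet fun x : fib o ↦ cls x.1)
  have hKmem : ∀ o (N : Matrix.SpecialLinearGroup (fib o) ℂ), N ∈ K o ↔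
      N.1ᵀ * Hb o * N.1 = Hb o ∧ ∀ x y : fib o, cls x.1 ≠ cls y.1 → N.1 x y = 0 := fun o N ↦ by
    rw [Subgroup.mem_inf, mem_map_map_symplecticGroupC_iff (hQ o) (hQHQ o), mem_centralizer_classDiagSet_iff]
  have hKc : ∀ o, IsZariskiClosed (K o) := fun o ↦
    (isZariskiClosed_and_isPrime_map_map_symplecticGroupC (e o) (hQ o)).1.inf (isZariskiClosed_centralizer _)
  have hKp : ∀ o, (vanishingIdealC (K o)).IsPrime := fun o ↦ by
    by_cases hone : ∀ x y : fib o, cls x.1 = cls y.1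
    · -- a fixed class: `K o = Sp(H_o)`
      have hKo : K o = ((symplecticGroupC (Fin (n o))).map (reindexSLC (e o).symm).toMonoidHom).map
          (conjGLC (Q o) (hQ o)).toMonoidHom :=
        le_antisymm inf_le_left (le_inf le_rfl fun N _ ↦
          (mem_centralizer_classDiagSet_iff _ N).2 fun x y hxy ↦ absurd (hone x y) hxy)
      rw [hKo]
      exact (isZariskiClosed_and_isPrime_map_map_symplecticGroupC (e o) (hQ o)).2
    · -- a pair of classes: the unitary block
      obtain ⟨x₀, hx₀⟩ := not_forall.1 hone
      obtain ⟨y₀, hx₀y₀⟩ := not_forall.1 hx₀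
      exact isPrime_vanishingIdealC_of_pair (fun x : fib o ↦ cls x.1) (cls x₀.1) (hHbt o) (hHbu o)
        (fun x y hxy ↦ hpair o x y ⟨x₀, y₀, hx₀y₀⟩ hxy) (htwo o x₀) (hKmem o)
  -- the product and its transport
  have hprime := isPrime_vanishingIdealC_sigmaPi_map hKc hKp
  suffices hS : lefschetzGroupC Φ G =
      (((Subgroup.pi Set.univ K).map (sigmaBlockDiagSL fib ℂ)).map (reindexSLC eσ).toMonoidHom).map
        (conjGLC P hP).toMonoidHom by
    rw [hS]
    exact isPrime_vanishingIdealC_map_conjGLC hP (isPrime_vanishingIdealC_map_reindexSLC eσ hprime)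
  -- the identification `S(X)(ℂ) = P · ∏_o S_o · P⁻¹`
  ext M
  rw [Subgroup.mem_map_equiv, Subgroup.mem_map_equiv, mem_lefschetzGroupC_iff]
  set B : Matrix ι ι ℂ := P⁻¹ * (M : Matrix ι ι ℂ) * P with hB_def
  have hMB : (M : Matrix ι ι ℂ) = P * B * P⁻¹ := by
    rw [hB_def, show P * (P⁻¹ * (M : Matrix ι ι ℂ) * P) * P⁻¹ = P * P⁻¹ * (M : Matrix ι ι ℂ) * (P * P⁻¹) by
      simp only [Matrix.mul_assoc], Matrix.mul_nonsing_inv _ hP, Matrix.one_mul, Matrix.mul_one]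
  have hcoeB' : (((reindexSLC eσ).symm ((conjGLC P hP).symm M) : Matrix.SpecialLinearGroup (Σ o, fib o) ℂ) :
      Matrix (Σ o, fib o) (Σ o, fib o) ℂ) = B.submatrix eσ eσ := by
    rw [coe_reindexSLC_symm, coe_conjGLC_symm]
  -- (1) the symplectic condition in the frame and in orbit coordinates
  have hsymp_iff : (M : Matrix ι ι ℂ)ᵀ * Γ * (M : Matrix ι ι ℂ) = Γ ↔
      (B.submatrix eσ eσ)ᵀ * H' * B.submatrix eσ eσ = H' := by
    rw [hMB, conj_symplectic_iff hP, ← hH_def, hH'_def]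
    constructor
    · intro h
      rw [show (B.submatrix ⇑eσ ⇑eσ)ᵀ = Bᵀ.submatrix eσ eσ from (Matrix.transpose_submatrix _ _ _).symm,
        Matrix.submatrix_mul_equiv, Matrix.submatrix_mul_equiv, h]
    · intro h
      rw [show (B.submatrix ⇑eσ ⇑eσ)ᵀ = Bᵀ.submatrix eσ eσ from (Matrix.transpose_submatrix _ _ _).symm,
        Matrix.submatrix_mul_equiv, Matrix.submatrix_mul_equiv] at h
      have h2 := congrArg (fun Y : Matrix _ _ ℂ ↦ Y.submatrix eσ.symm eσ.symm) h
      simp only [Matrix.submatrix_submatrix, Equiv.self_comp_symm, Matrix.submatrix_id_id] at h2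
      exact h2
  -- (2) commuting with `End_ℚ(X) ⊗ 1` ⟺ vanishing between different character classes
  have hne_iff : ∀ i k, cls i ≠ cls k ↔ ∃ t ∈ endAlgRat Φ, c t i ≠ c t k := fun i k ↦ by
    rw [Ne, hcls, not_forall]
    exact exists_congr fun t ↦ by rw [Classical.not_imp]
  have hcomm_iff : (∀ A ∈ endAlgRat Φ, (M : Matrix ι ι ℂ) * A.map (algebraMap ℚ ℂ) = A.map (algebraMap ℚ ℂ) * M) ↔
      ∀ x x' : Σ o, fib o, cls (eσ x) ≠ cls (eσ x') → B.submatrix eσ eσ x x' = 0 := by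
    constructor
    · intro h x x' hxx'
      obtain ⟨t, ht, hne⟩ := (hne_iff _ _).1 hxx'
      have h1 := h t ht
      rw [hMB, hc t ht, conjFrame_mul_comm_iff_cc hP, mul_diagonal_comm_iff_cc] at h1
      exact h1 _ _ hne
    · intro h A hA
      rw [hMB, hc A hA, conjFrame_mul_comm_iff_cc hP, mul_diagonal_comm_iff_cc]
      intro i k hik
      have h1 := h (eσ.symm i) (eσ.symm k)
        ((hne_iff _ _).2 ⟨A, hA, by rwa [Equiv.apply_symm_apply, Equiv.apply_symm_apply]⟩)
      rwa [Matrix.submatrix_apply, Equiv.apply_symm_apply, Equiv.apply_symm_apply] at h1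
  rw [hsymp_iff, hcomm_iff]
  constructor
  · -- `S(X)(ℂ) ⊆ P · ∏ S_o · P⁻¹`
    rintro ⟨hsymp, hblk⟩
    set B' := B.submatrix eσ eσ with hB'_def
    have hblk' : ∀ x x' : Σ o, fib o, x.1 ≠ x'.1 → B' x x' = 0 := fun x x' hxx' ↦
      hblk x x' fun h ↦ hxx' (by rw [← heσ x, ← heσ x']; exact hocls_of_cls _ _ h)
    have hB'eq : B' = Matrix.blockDiagonal' (Matrix.blockDiag' B') := eq_blockDiagonal'_blockDiag'_of_apply_eq_zero hblk'
    -- blockwise symplectic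
    have hblocks : ∀ o, (Matrix.blockDiag' B' o)ᵀ * Hb o * Matrix.blockDiag' B' o = Hb o := by
      have h := hsymp
      rw [hB'eq, hH'eq, Matrix.blockDiagonal'_transpose, ← Matrix.blockDiagonal'_mul, ← Matrix.blockDiagonal'_mul] at h
      exact fun o ↦ congrFun (Matrix.blockDiagonal'_injective h) o
    have hdet : ∀ o, (Matrix.blockDiag' B' o).det = 1 := fun o ↦
      det_eq_one_of_transpose_mul_mul_eq_complex (hHbt o) (hHbu o) (hblocks o)
    have hmem := eq_sigmaBlockDiagSL_of_apply_eq_zero (M := (reindexSLC eσ).symm ((conjGLC P hP).symm M))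
      (by rw [hcoeB']; exact hblk') (by rw [hcoeB']; exact hdet)
    rw [hmem]
    refine Subgroup.mem_map.2 ⟨_, (Subgroup.mem_pi _).2 fun o _ ↦ (hKmem o _).2 ⟨?_, fun x y hxy ↦ ?_⟩, rfl⟩
    · change (Matrix.blockDiag' _ o)ᵀ * Hb o * Matrix.blockDiag' _ o = Hb o
      rw [hcoeB']
      exact hblocks o
    · change Matrix.blockDiag' _ o x y = 0
      rw [hcoeB', Matrix.blockDiag'_apply]
      exact hblk ⟨o, x⟩ ⟨o, y⟩ hxy
  · -- `P · ∏ S_o · P⁻¹ ⊆ S(X)(ℂ)`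
    intro hmem
    obtain ⟨A, hA, hAeq⟩ := Subgroup.mem_map.1 hmem
    have hB' : B.submatrix eσ eσ = Matrix.blockDiagonal' fun o ↦ ((A o : Matrix.SpecialLinearGroup (fib o) ℂ) :
        Matrix (fib o) (fib o) ℂ) := by
      rw [← hcoeB', ← hAeq, coe_sigmaBlockDiagSL]
    have hAo : ∀ o, ((A o : Matrix.SpecialLinearGroup (fib o) ℂ) : Matrix (fib o) (fib o) ℂ)ᵀ * Hb o * (A o) = Hb o ∧
        ∀ x y : fib o, cls x.1 ≠ cls y.1 → ((A o : Matrix.SpecialLinearGroup (fib o) ℂ) : Matrix (fib o) (fib o) ℂ)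
          x y = 0 :=
      fun o ↦ (hKmem o (A o)).1 ((Subgroup.mem_pi _).1 hA o (Set.mem_univ o))
    refine ⟨?_, fun x x' hxx' ↦ ?_⟩
    · rw [hB', hH'eq, Matrix.blockDiagonal'_transpose, ← Matrix.blockDiagonal'_mul, ← Matrix.blockDiagonal'_mul]
      exact congrArg Matrix.blockDiagonal' (funext fun o ↦ (hAo o).1)
    · rw [hB']
      obtain ⟨o, x⟩ := x
      obtain ⟨o', y⟩ := x'
      by_cases hoo : o = o'
      · subst hoo
        rw [Matrix.blockDiagonal'_apply_eq]
        exact (hAo o).2 x y hxx'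
      · exact Matrix.blockDiagonal'_apply_ne _ x y hoo

/-- **`Lf(X)(ℂ) = S(X)(ℂ)` for a complex torus with commutative endomorphism algebra** (`End_ℚ(X)` commutative and
reduced, `G` alternating non-degenerate rational with `End_ℚ(X)` Rosati-stable): Lange's identity component `Lf(X)`
is all of Milne's `S(X)` — Milne's table, types I (`E = F`) and IV (`E = K`), every degree and every relative
dimension; rows A4-92 (`[End_ℚ(X) : ℚ] = 2g`) and A4-93 (`† = 1`) are the extreme cases.
[cite: Milne1999LefschetzClasses, §2 Remark 2.2, «Simple abelian variety of type I», «… of type IV» and Summary table (p. 652)]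
[cite: Lange2023AbelianVarietiesComplex, §7.2.4 Exercise (4)] -/
theorem lefschetzIdentityC_eq_lefschetzGroupC_of_endAlgRat_comm' [IsReduced (endAlgRat Φ)]
    (hcomm : ∀ a ∈ endAlgRat Φ, ∀ b ∈ endAlgRat Φ, a * b = b * a)
    {G : Matrix ι ι ℚ} (hGt : Gᵀ = -G) (hGu : IsUnit G.det) (hEnd : ∀ A ∈ endAlgRat Φ, rosati G A ∈ endAlgRat Φ) :
    lefschetzIdentityC Φ G = lefschetzGroupC Φ G :=
  lefschetzIdentityC_eq_of_isPrime Φ (isPrime_vanishingIdealC_lefschetzGroupC_of_endAlgRat_comm' Φ hcomm hGt hGu hEnd)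

/-- **The polarised form: for a polarised abelian variety `(X, η)` with COMMUTATIVE endomorphism algebra,
`Lf(X)(ℂ) = S(X)(ℂ)`** (`End_ℚ(X)` is semisimple by Poincaré, hence reduced; the Gram matrix `G` of `η` is
alternating, non-degenerate, and its Rosati involution preserves `End_ℚ(X)`). Milne's table: a product of number
fields `E = ∏ E_j` (each `F` or `K`) has «Connected: Yes».
[cite: Milne1999LefschetzClasses, §2 Summary table (p. 652: «I ∣ Sp ∣ Yes ∣ Yes», «IV ∣ GL ∣ No ∣ Yes»)]
[cite: Lange2023AbelianVarietiesComplex, §2.4.1 Lemma 2.4.1, §7.2.4 Exercise (4)] -/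
theorem IsRiemannForm.lefschetzIdentityC_eq_lefschetzGroupC_of_endAlgRat_comm' {Φ : (ι → ℝ) ≃L[ℝ] E}
    {η : E [⋀^Fin 2]→L[ℝ] ℝ} (hη : IsRiemannForm Φ η) {G : Matrix ι ι ℚ}
    (hG : G.map (Rat.cast : ℚ → ℝ) = latticeGram Φ η)
    (hcomm : ∀ a ∈ endAlgRat Φ, ∀ b ∈ endAlgRat Φ, a * b = b * a) :
    lefschetzIdentityC Φ G = lefschetzGroupC Φ G := by
  haveI := hη.isSemisimpleRing_endAlgRat
  letI : CommRing (endAlgRat Φ) :=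
    { (inferInstance : Ring (endAlgRat Φ)) with mul_comm := fun a b ↦ Subtype.ext (hcomm a.1 a.2 b.1 b.2) }
  haveI : IsReduced (endAlgRat Φ) := inferInstance
  exact ComplexTorus.lefschetzIdentityC_eq_lefschetzGroupC_of_endAlgRat_comm' Φ hcomm
    (transpose_eq_neg_of_map_ratCast Φ hG) (isUnit_det_of_map_ratCast hG hη.isUnit_det_latticeGram)
    fun A hA ↦ rosati_mem_endAlgRat Φ hη.1 hη.2.2 hG hA

/-- The polarised form, irreducibility: `I_ℂ(S(X)(ℂ))` is prime for a polarised abelian variety with commutative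
endomorphism algebra. [cite: Milne1999LefschetzClasses, §2 Summary table (types I and IV: «Connected: Yes»)] -/
theorem IsRiemannForm.isPrime_vanishingIdealC_lefschetzGroupC_of_endAlgRat_comm' {Φ : (ι → ℝ) ≃L[ℝ] E}
    {η : E [⋀^Fin 2]→L[ℝ] ℝ} (hη : IsRiemannForm Φ η) {G : Matrix ι ι ℚ}
    (hG : G.map (Rat.cast : ℚ → ℝ) = latticeGram Φ η)
    (hcomm : ∀ a ∈ endAlgRat Φ, ∀ b ∈ endAlgRat Φ, a * b = b * a) :
    (vanishingIdealC (lefschetzGroupC Φ G)).IsPrime := by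
  rw [isPrime_vanishingIdealC_lefschetzGroupC_iff]
  exact hη.lefschetzIdentityC_eq_lefschetzGroupC_of_endAlgRat_comm' hG hcomm

/-- Real points: `Lf(X)(ℝ) = S(X)(ℝ) = lefschetzGroup Φ η` for a polarised abelian variety with commutative
endomorphism algebra. [cite: Milne1999LefschetzClasses, §2 Summary table (types I and IV: «Connected: Yes»)]
[cite: Lange2023AbelianVarietiesComplex, §7.2.4 Exercise (4)] -/
theorem IsRiemannForm.lefschetzIdentity_eq_lefschetzGroup_of_endAlgRat_comm' {Φ : (ι → ℝ) ≃L[ℝ] E}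
    {η : E [⋀^Fin 2]→L[ℝ] ℝ} (hη : IsRiemannForm Φ η) {G : Matrix ι ι ℚ}
    (hG : G.map (Rat.cast : ℚ → ℝ) = latticeGram Φ η)
    (hcomm : ∀ a ∈ endAlgRat Φ, ∀ b ∈ endAlgRat Φ, a * b = b * a) :
    lefschetzIdentity Φ G = lefschetzGroup Φ η := by
  rw [← comap_lefschetzGroupC Φ hG, ← hη.lefschetzIdentityC_eq_lefschetzGroupC_of_endAlgRat_comm' hG hcomm]
  rfl

end Commutative

/-! ## §4 Through the isogeny factors -/

section IsogenyFactors

variable {K : Type*} [Fintype K] [DecidableEq K] {σ : K → Type*} [∀ k, Fintype (σ k)] [∀ k, DecidableEq (σ k)]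
  {F : K → Type*} [∀ k, NormedAddCommGroup (F k)] [∀ k, NormedSpace ℂ (F k)] [∀ k, FiniteDimensional ℂ (F k)]
  {Ψ : ∀ k, (σ k → ℝ) ≃L[ℝ] F k} {ω : ∀ k, F k [⋀^Fin 2]→L[ℝ] ℝ} {G : ∀ k, Matrix (σ k) (σ k) ℚ} {n : K → ℕ}
  {ι : Type*} [Fintype ι] [DecidableEq ι] {E : Type*} [NormedAddCommGroup E] [NormedSpace ℂ E]
  {Φ : (ι → ℝ) ≃L[ℝ] E} {η : E [⋀^Fin 2]→L[ℝ] ℝ} {G₀ : Matrix ι ι ℚ}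

/-- **An abelian variety isogenous to a product of powers of polarised factors with COMMUTATIVE endomorphism algebras
has connected `S(X)`: `Lf(X)(ℂ) = S(X)(ℂ)`** (Milne's Prop. 1.5 `S(A₁) × ⋯ × S(A_s) → S(A)` with the «Connected: Yes»
entries I and IV of the table; `Hom_ℚ(B_k, B_l) = 0` for `k ≠ l`, `n_k ≥ 1`).
[cite: Milne1999LefschetzClasses, §1 Prop. 1.5 (p. 644) and §2 Summary table (p. 652: «I … Yes», «IV … Yes»)] -/
theorem IsIsogenous.lefschetzIdentityC_eq_lefschetzGroupC_of_powers_of_endAlgRat_comm'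
    (hX : IsIsogenous Φ (sigmaPiPeriod fun k ↦ powPeriod (Ψ k) (n k))) (hη : IsRiemannForm Φ η)
    (hG₀ : G₀.map (Rat.cast : ℚ → ℝ) = latticeGram Φ η) (h : ∀ k, IsRiemannForm (Ψ k) (ω k))
    (hG : ∀ k, (G k).map (Rat.cast : ℚ → ℝ) = latticeGram (Ψ k) (ω k))
    (hhom : ∀ k l, k ≠ l → homRat (Ψ l) (Ψ k) = ⊥) (hn : ∀ k, 0 < n k)
    (hcomm : ∀ k, ∀ a ∈ endAlgRat (Ψ k), ∀ b ∈ endAlgRat (Ψ k), a * b = b * a) :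
    lefschetzIdentityC Φ G₀ = lefschetzGroupC Φ G₀ :=
  hX.lefschetzIdentityC_eq_lefschetzGroupC_of_powers hη hG₀ h hG hhom hn fun k ↦
    (h k).lefschetzIdentityC_eq_lefschetzGroupC_of_endAlgRat_comm' (hG k) (hcomm k)

/-- The same, irreducibility form: `I_ℂ(S(X)(ℂ))` is prime. [cite: Milne1999LefschetzClasses, §1 Prop. 1.5 and §2 Summary table] -/
theorem IsIsogenous.isPrime_vanishingIdealC_lefschetzGroupC_of_powers_of_endAlgRat_comm'
    (hX : IsIsogenous Φ (sigmaPiPeriod fun k ↦ powPeriod (Ψ k) (n k))) (hη : IsRiemannForm Φ η)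
    (hG₀ : G₀.map (Rat.cast : ℚ → ℝ) = latticeGram Φ η) (h : ∀ k, IsRiemannForm (Ψ k) (ω k))
    (hG : ∀ k, (G k).map (Rat.cast : ℚ → ℝ) = latticeGram (Ψ k) (ω k))
    (hhom : ∀ k l, k ≠ l → homRat (Ψ l) (Ψ k) = ⊥) (hn : ∀ k, 0 < n k)
    (hcomm : ∀ k, ∀ a ∈ endAlgRat (Ψ k), ∀ b ∈ endAlgRat (Ψ k), a * b = b * a) :
    (vanishingIdealC (lefschetzGroupC Φ G₀)).IsPrime := by
  rw [isPrime_vanishingIdealC_lefschetzGroupC_iff]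
  exact hX.lefschetzIdentityC_eq_lefschetzGroupC_of_powers_of_endAlgRat_comm' hη hG₀ h hG hhom hn hcomm

end IsogenyFactors

end ComplexTorus

end Literature.Geometry.Kaehler
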